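import Mathlib
import HarnessLib
import Summits.RiemannHypothesis.RiemannHypothesis.Theorems.IntegerScrewFloorConstantDefs
import Summits.RiemannHypothesis.RiemannHypothesis.Theorems.IntegerScrewNestedSylvester
import Summits.RiemannHypothesis.RiemannHypothesis.Theorems.IntegerScrewPivotCriterion

/-!
# Route `IntegerScrew` — the floor constant `c(M)` and RH: kernel LABELS for the SCREW column's
row S-P (P1) statements (`IntegerScrewFloorConstantDefs`), with an ERRATUM to that file's docstring

`c(M) = screwFloor M = M · inf_{v ≠ 0} vᵀ S_M v / vᵀ v` (`S_M = screwMatrix (M − 1)`).  This file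
proves, from Suzuki's criterion `RH ↔ ∀ n, screwMatrix n ≻ 0`
(`riemannHypothesis_iff_screwMatrix_posDef`, Suzuki2023 Thm 1.1 as landed in the tree) and the
nestedness of the family (`screwMatrix_posDef_of_le`):

* `riemannHypothesis_iff_screwFloor_pos_two_le` : `RH ↔ ∀ M ≥ 2, 0 < c(M)`;
* `riemannHypothesis_iff_eventually_screwFloor_pos` : `RH ↔ (0 < c(M) for all large M)`;
* `riemannHypothesis_of_screwFloorQuarterLimit` / `_of_screwFloorLaw` /
  `_of_screwFloorSecondOrderLaw` : each of the three conjectures of `IntegerScrewFloorConstantDefs`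
  that pin a POSITIVE LIMIT / two-sided law on `c(M)` IMPLIES RH.

ERRATUM (labels, ladder rule §5.4).  The module docstring of `IntegerScrewFloorConstantDefs` calls
all five `Prop`s there «RH-FREE IN KIND».  That is correct ONLY for the two UPPER statements
`ScrewFloorTrialBound` and `ScrewFloorLimsupQuarter` (true trivially without RH, by the eta trial
vector with RH).  The three statements `ScrewFloorQuarterLimit` (`c(M) → 1/4`), `ScrewFloorLaw`,
`ScrewFloorSecondOrderLaw` are of RH STRENGTH: by the theorems below each implies RH, and RH is
known to give back only `0 < c(M)` (the value `1/4` of the limit is lineage C's conjecture).  So the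
SCREW column's P1 target splits as: (P1-upper, RH-FREE) `ScrewFloorTrialBound`; (P1-limit,
RH-STRENGTH = RH ∧ «the eta direction is asymptotically extremal») `ScrewFloorQuarterLimit`.
A closed form for `c_∞` is therefore not RH-free content unless stated as an UPPER bound or
conditionally on RH.

THE CASE SPLIT OF THE RH-FREE LEAF (last section; SCREW-THEORY-R1 §1b T-a in kernel form):
* `screwFloorTrialBound_of_not_riemannHypothesis`, `screwFloorLimsupQuarter_of_not_riemannHypothesis` :
  `¬RH` gives both upper laws trivially (`c(M) ≤ 0` for all large `M`);
* `screwFloorTrialBound_iff_of_riemannHypothesis` : `ScrewFloorTrialBound ↔ (RH → ScrewFloorTrialBound)`;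
* `screwFloorTrialBound_iff_trialVectors` : THEOREM B `↔` for every `ε > 0` and all large `M` with
  `S_M ≻ 0` some `v ≠ 0` has `M·vᵀS_Mv/vᵀv ≤ 1/4 + (a′+ε)/log M` — the exact shape of the
  trial-vector architecture of TRIAL-BOUND-THEOREM.md (what a prover of the leaf must exhibit).
Nothing in this file bears on the truth of RH.
-/

noncomputable section

-- D-0017: `Summit.<S>.<S>.…` is the designed namespace of a single-problem summit.
set_option linter.dupNamespace false

namespace Summit.RiemannHypothesis.RiemannHypothesis.Theorems.IntegerScrew

open Literature.NumberTheory.LFunctions Matrix Filter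
open scoped BigOperators Topology

/-! ### From a positive floor constant to positive definiteness -/

/-- The set of Rayleigh quotients of `S_M` over nonzero vectors (the set whose infimum, times `M`,
is `screwFloor M`). [folklore] -/
private def rayleighSet (M : ℕ) : Set ℝ :=
  {q : ℝ | ∃ v : Fin (M - 1) → ℝ, v ≠ 0 ∧ q = screwRayleigh M v}

/-- `screwFloor M = M · inf (rayleighSet M)` (definitional unfolding). [folklore] -/
private theorem screwFloor_eq (M : ℕ) : screwFloor M = (M : ℝ) * sInf (rayleighSet M) := rfl

/-- If `c(M) > 0` then the Rayleigh set is nonempty and bounded below (otherwise its `sInf` is the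
junk value `0`) and its infimum is positive. [folklore] -/
private theorem sInf_rayleighSet_pos {M : ℕ} (h : 0 < screwFloor M) :
    BddBelow (rayleighSet M) ∧ 0 < sInf (rayleighSet M) := by
  rw [screwFloor_eq] at h
  have hpos : 0 < sInf (rayleighSet M) := by
    rcases lt_or_ge 0 (sInf (rayleighSet M)) with h1 | h1
    · exact h1
    · exact absurd h (not_lt.2 (mul_nonpos_of_nonneg_of_nonpos (Nat.cast_nonneg M) h1))
  refine ⟨?_, hpos⟩
  by_contra hbdd
  rw [Real.sInf_of_not_bddBelow hbdd] at hpos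
  exact lt_irrefl 0 hpos

/-- **`c(M) > 0 ⟹` every Rayleigh quotient of `S_M` is positive.** [folklore] -/
theorem screwRayleigh_pos_of_screwFloor_pos {M : ℕ} (h : 0 < screwFloor M)
    {v : Fin (M - 1) → ℝ} (hv : v ≠ 0) : 0 < screwRayleigh M v := by
  obtain ⟨hbdd, hpos⟩ := sInf_rayleighSet_pos h
  exact hpos.trans_le (csInf_le hbdd ⟨v, hv, rfl⟩)

/-- `vᵀv > 0` for a nonzero real vector. [folklore] -/
private theorem dotProduct_self_pos' {k : ℕ} {v : Fin k → ℝ} (hv : v ≠ 0) : 0 < v ⬝ᵥ v :=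
  lt_of_le_of_ne (Finset.sum_nonneg fun i _ => mul_self_nonneg (v i))
    (fun h0 => hv (dotProduct_self_eq_zero.1 h0.symm))

/-- **`c(M) > 0 ⟹ S_M ≻ 0`** (`S_M = screwMatrix (M − 1)`): a positive Rayleigh quotient with
`vᵀv > 0` gives `vᵀ S_M v > 0`. [folklore] -/
theorem screwMatrix_posDef_of_screwFloor_pos {M : ℕ} (h : 0 < screwFloor M) :
    (screwMatrix (M - 1)).PosDef := by
  refine Matrix.PosDef.of_dotProduct_mulVec_pos (screwMatrix_isHermitian (M - 1)) fun v hv => ?_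
  have hq := screwRayleigh_pos_of_screwFloor_pos h hv
  have hvv : 0 < v ⬝ᵥ v := dotProduct_self_pos' hv
  unfold screwRayleigh at hq
  rw [star_trivial]
  exact (div_pos_iff_of_pos_right hvv).1 hq

/-- **Eventual positivity of the floor constant implies `S_n ≻ 0` for every `n`** (nestedness:
`screwMatrix n` is a leading block of `screwMatrix (M − 1)` for `n ≤ M − 1`,
`IntegerScrewNestedSylvester.screwMatrix_posDef_of_le`). [folklore] -/
theorem screwMatrix_posDef_of_eventually_screwFloor_pos
    (h : ∀ᶠ M : ℕ in atTop, 0 < screwFloor M) (n : ℕ) : (screwMatrix n).PosDef := by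
  obtain ⟨M₀, hM₀⟩ := eventually_atTop.1 h
  have hM : 0 < screwFloor (max M₀ (n + 1)) := hM₀ _ (le_max_left _ _)
  have hle : n ≤ max M₀ (n + 1) - 1 := by omega
  exact screwMatrix_posDef_of_le hle (screwMatrix_posDef_of_screwFloor_pos hM)

/-- **RH-STRENGTH LABEL (kernel form): eventual positivity of `c(M)` already implies RH**
(`riemannHypothesis_iff_screwMatrix_posDef`, Suzuki2023 Thm 1.1 + nestedness).  Hence every
statement asserting a POSITIVE LIMIT or a two-sided asymptotic law for `c(M)` implies RH.
[cite: Suzuki2023, Theorem 1.1] -/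
theorem riemannHypothesis_of_eventually_screwFloor_pos
    (h : ∀ᶠ M : ℕ in atTop, 0 < screwFloor M) : _root_.RiemannHypothesis :=
  riemannHypothesis_iff_screwMatrix_posDef.2 (screwMatrix_posDef_of_eventually_screwFloor_pos h)

/-- `c(M) → 1/4 ⟹ c(M) > 0` eventually. [folklore] -/
theorem eventually_screwFloor_pos_of_quarterLimit (h : ScrewFloorQuarterLimit) :
    ∀ᶠ M : ℕ in atTop, 0 < screwFloor M :=
  h.eventually (lt_mem_nhds (by norm_num : (0 : ℝ) < 1 / 4))

/-- **`ScrewFloorQuarterLimit ⟹ RH`.**  The conjecture `c(M) → 1/4` is of RH STRENGTH (it is NOT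
RH-free): it implies RH outright; conversely RH is only known to give `c(M) > 0`
(`riemannHypothesis_iff_screwFloor_pos_two_le` below), the value `1/4` of the limit being lineage C's
conjecture.  ERRATUM to the module docstring of `IntegerScrewFloorConstantDefs` («RH-free in kind»):
that label is correct for the UPPER statements `ScrewFloorTrialBound`, `ScrewFloorLimsupQuarter` only.
[cite: Suzuki2023, Theorem 1.1] -/
theorem riemannHypothesis_of_screwFloorQuarterLimit (h : ScrewFloorQuarterLimit) :
    _root_.RiemannHypothesis :=
  riemannHypothesis_of_eventually_screwFloor_pos (eventually_screwFloor_pos_of_quarterLimit h)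

/-- **`ScrewFloorLaw ⟹ RH`** (via `ScrewFloorQuarterLimit`). [cite: Suzuki2023, Theorem 1.1] -/
theorem riemannHypothesis_of_screwFloorLaw (h : ScrewFloorLaw) : _root_.RiemannHypothesis :=
  riemannHypothesis_of_screwFloorQuarterLimit (screwFloorQuarterLimit_of_law h)

/-- **`ScrewFloorSecondOrderLaw ⟹ RH`** (via `ScrewFloorLaw`). [cite: Suzuki2023, Theorem 1.1] -/
theorem riemannHypothesis_of_screwFloorSecondOrderLaw (h : ScrewFloorSecondOrderLaw) :
    _root_.RiemannHypothesis :=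
  riemannHypothesis_of_screwFloorLaw (screwFloorLaw_of_secondOrderLaw h)

/-! ### From positive definiteness to a positive floor constant (compactness of the unit sphere) -/

/-- **`S_M ≻ 0 ⟹ c(M) > 0`** for `M ≥ 2`: the quadratic form attains a positive minimum `m` on the
(compact, nonempty) sup-norm unit sphere of `ℝ^{M−1}`, and every Rayleigh quotient is
`≥ m/(M − 1)` (`vᵀS v ≥ m‖v‖∞²`, `vᵀv ≤ (M−1)‖v‖∞²`). [folklore] -/
theorem screwFloor_pos_of_posDef {M : ℕ} (hM : 2 ≤ M) (h : (screwMatrix (M - 1)).PosDef) :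
    0 < screwFloor M := by
  set k := M - 1 with hk
  have hk1 : 1 ≤ k := by omega
  -- the quadratic form and its minimum on the unit sphere
  set f : (Fin k → ℝ) → ℝ := fun v => v ⬝ᵥ (screwMatrix k *ᵥ v) with hf
  have hfc : Continuous f := continuous_id.dotProduct (continuous_const.matrix_mulVec continuous_id)
  have hKc : IsCompact (Metric.sphere (0 : Fin k → ℝ) 1) := isCompact_sphere _ _
  have hKne : (Metric.sphere (0 : Fin k → ℝ) 1).Nonempty := by
    refine ⟨Pi.single ⟨0, hk1⟩ 1, ?_⟩
    rw [mem_sphere_zero_iff_norm, Pi.norm_single, norm_one]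
  obtain ⟨v₀, hv₀K, hv₀min⟩ := hKc.exists_isMinOn hKne hfc.continuousOn
  have hv₀ne : v₀ ≠ 0 := by
    rintro rfl
    rw [mem_sphere_zero_iff_norm, norm_zero] at hv₀K
    exact zero_ne_one hv₀K
  have hm : 0 < f v₀ := by simpa only [hf, star_trivial] using h.dotProduct_mulVec_pos hv₀ne
  -- every Rayleigh quotient is ≥ f v₀ / k
  have hbound : ∀ q ∈ rayleighSet M, f v₀ / k ≤ q := by
    rintro q ⟨v, hv, rfl⟩
    have hvn : 0 < ‖v‖ := norm_pos_iff.2 hv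
    set u : Fin k → ℝ := ‖v‖⁻¹ • v with hu
    have huK : u ∈ Metric.sphere (0 : Fin k → ℝ) 1 := by
      rw [mem_sphere_zero_iff_norm, hu, norm_smul, norm_inv, norm_norm, inv_mul_cancel₀ hvn.ne']
    have hfu : f v₀ ≤ f u := hv₀min huK
    have hvu : v = ‖v‖ • u := by rw [hu, smul_smul, mul_inv_cancel₀ hvn.ne', one_smul]
    -- vᵀ S v = ‖v‖² · uᵀ S u
    have hnum : v ⬝ᵥ (screwMatrix k *ᵥ v) = ‖v‖ ^ 2 * f u := by
      calc v ⬝ᵥ (screwMatrix k *ᵥ v) = (‖v‖ • u) ⬝ᵥ (screwMatrix k *ᵥ (‖v‖ • u)) := by rw [← hvu]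
        _ = ‖v‖ ^ 2 * f u := by
          simp only [hf, mulVec_smul, dotProduct_smul, smul_dotProduct, smul_eq_mul]; ring
    -- vᵀ v ≤ k ‖v‖²
    have hden : v ⬝ᵥ v ≤ k * ‖v‖ ^ 2 := by
      calc v ⬝ᵥ v = ∑ i, v i * v i := rfl
        _ ≤ ∑ _i : Fin k, ‖v‖ ^ 2 := Finset.sum_le_sum fun i _ => by
            have h1 : |v i| ≤ ‖v‖ := by simpa only [Real.norm_eq_abs] using norm_le_pi_norm v i
            have h2 : v i * v i = |v i| ^ 2 := by rw [← sq, sq_abs]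
            rw [h2]; exact pow_le_pow_left₀ (abs_nonneg _) h1 2
        _ = k * ‖v‖ ^ 2 := by simp
    have hden0 : 0 < v ⬝ᵥ v := dotProduct_self_pos' hv
    have hkpos : (0 : ℝ) < k := by exact_mod_cast hk1
    show f v₀ / k ≤ screwRayleigh M v
    unfold screwRayleigh
    rw [div_le_div_iff₀ hkpos hden0, hnum]
    calc f v₀ * (v ⬝ᵥ v) ≤ f v₀ * (k * ‖v‖ ^ 2) := by gcongr
      _ = ‖v‖ ^ 2 * f v₀ * k := by ring
      _ ≤ ‖v‖ ^ 2 * f u * k := by gcongr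
  have hne : (rayleighSet M).Nonempty :=
    ⟨screwRayleigh M (Pi.single ⟨0, hk1⟩ 1), Pi.single ⟨0, hk1⟩ 1,
      by simp [Pi.single_eq_zero_iff], rfl⟩  -- nonzero vector
  have hinf : f v₀ / k ≤ sInf (rayleighSet M) := le_csInf hne hbound
  have hMpos : (0 : ℝ) < M := by exact_mod_cast (by omega : 0 < M)
  rw [screwFloor_eq]
  exact mul_pos hMpos ((div_pos hm (by exact_mod_cast hk1)).trans_le hinf)

/-- **`RH ↔ ∀ M ≥ 2, c(M) > 0`** — the floor-constant form of Suzuki's criterion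
(`riemannHypothesis_iff_screwMatrix_posDef`; `M = 1` is the empty matrix).  This is the precise
sense of the ladder's «C-IV ∀M ⇔ RH»: positivity of EVERY `c(M)` is RH; no statement about the
SIZE of `c(M)` from above is. [cite: Suzuki2023, Theorem 1.1] -/
theorem riemannHypothesis_iff_screwFloor_pos_two_le :
    _root_.RiemannHypothesis ↔ ∀ M : ℕ, 2 ≤ M → 0 < screwFloor M := by
  constructor
  · intro hRH M hM
    exact screwFloor_pos_of_posDef hM (riemannHypothesis_iff_screwMatrix_posDef.1 hRH (M - 1))
  · intro h
    exact riemannHypothesis_of_eventually_screwFloor_pos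
      (eventually_atTop.2 ⟨2, fun M hM => h M hM⟩)

/-- **`RH ↔ c(M) > 0 eventually`** — by nestedness, eventual positivity is as strong as positivity
for all `M ≥ 2`. [cite: Suzuki2023, Theorem 1.1] -/
theorem riemannHypothesis_iff_eventually_screwFloor_pos :
    _root_.RiemannHypothesis ↔ ∀ᶠ M : ℕ in atTop, 0 < screwFloor M :=
  ⟨fun hRH => eventually_atTop.2
      ⟨2, fun M hM => (riemannHypothesis_iff_screwFloor_pos_two_le.1 hRH) M hM⟩,
    riemannHypothesis_of_eventually_screwFloor_pos⟩

/-! ### The `¬RH` branch and the trial-vector form of the RH-free upper laws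
(SCREW-THEORY-R1 §1b T-a, kernel form: «¬RH ⇒ trivial; RH ⇒ the trial-vector calculus») -/

/-- **`S_M ⊁ 0 ⟹ c(M) ≤ 0`** (contrapositive of `screwMatrix_posDef_of_screwFloor_pos`). [folklore] -/
theorem screwFloor_nonpos_of_not_posDef {M : ℕ} (h : ¬ (screwMatrix (M - 1)).PosDef) :
    screwFloor M ≤ 0 :=
  not_lt.1 fun hc => h (screwMatrix_posDef_of_screwFloor_pos hc)

/-- **`¬RH ⟹ c(M) ≤ 0` for all large `M`**: some `S_n` is not positive definite
(`riemannHypothesis_iff_screwMatrix_posDef`), hence by nestedness (`screwMatrix_posDef_of_le`) no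
`S_{M−1}` with `n ≤ M − 1` is. [folklore] -/
theorem eventually_screwFloor_nonpos_of_not_riemannHypothesis (h : ¬ _root_.RiemannHypothesis) :
    ∀ᶠ M : ℕ in atTop, screwFloor M ≤ 0 := by
  obtain ⟨n, hn⟩ : ∃ n, ¬ (screwMatrix n).PosDef :=
    not_forall.1 fun hall => h (riemannHypothesis_iff_screwMatrix_posDef.2 hall)
  refine eventually_atTop.2 ⟨n + 1, fun M hM => screwFloor_nonpos_of_not_posDef fun hPD => hn ?_⟩
  exact screwMatrix_posDef_of_le (by omega) hPD

/-- The threshold side: `a/log M → 0`, so eventually `0 ≤ 1/4 + a/log M` (no sign information on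
`a` is used). [folklore] -/
theorem eventually_quarter_add_div_log_nonneg (a : ℝ) :
    ∀ᶠ M : ℕ in atTop, (0 : ℝ) ≤ 1 / 4 + a / Real.log M := by
  have hlog : Tendsto (fun M : ℕ => Real.log (M : ℝ)) atTop atTop :=
    Real.tendsto_log_atTop.comp tendsto_natCast_atTop_atTop
  have h1 : Tendsto (fun M : ℕ => 1 / 4 + a / Real.log (M : ℝ)) atTop (𝓝 (1 / 4 + 0)) :=
    tendsto_const_nhds.add (tendsto_const_nhds.div_atTop hlog)
  rw [add_zero] at h1
  exact h1.eventually (eventually_ge_nhds (by norm_num : (0 : ℝ) < 1 / 4))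

/-- **`¬RH ⟹ ScrewFloorTrialBound`** — the trivial branch of THEOREM B: eventually
`c(M) ≤ 0 ≤ 1/4 + (a′ + ε)/log M`. [folklore] -/
theorem screwFloorTrialBound_of_not_riemannHypothesis (h : ¬ _root_.RiemannHypothesis) :
    ScrewFloorTrialBound := fun ε _ =>
  ((eventually_screwFloor_nonpos_of_not_riemannHypothesis h).and
    (eventually_quarter_add_div_log_nonneg (screwFloorFirstOrderConst + ε))).mono
    fun _ hM => hM.1.trans hM.2

/-- **`¬RH ⟹ ScrewFloorLimsupQuarter`.** [folklore] -/
theorem screwFloorLimsupQuarter_of_not_riemannHypothesis (h : ¬ _root_.RiemannHypothesis) :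
    ScrewFloorLimsupQuarter := fun ε hε =>
  (eventually_screwFloor_nonpos_of_not_riemannHypothesis h).mono fun _ hM => by linarith

/-- **THE CASE SPLIT (kernel form).** The RH-free leaf `ScrewFloorTrialBound` is equivalent to its
RH-conditional core: only the branch `RH ⟹ THEOREM B` carries content. [folklore] -/
theorem screwFloorTrialBound_iff_of_riemannHypothesis :
    ScrewFloorTrialBound ↔ (_root_.RiemannHypothesis → ScrewFloorTrialBound) :=
  ⟨fun h _ => h, fun h => (em _root_.RiemannHypothesis).elim h
    screwFloorTrialBound_of_not_riemannHypothesis⟩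

/-- The same case split for `ScrewFloorLimsupQuarter` (THEOREM A). [folklore] -/
theorem screwFloorLimsupQuarter_iff_of_riemannHypothesis :
    ScrewFloorLimsupQuarter ↔ (_root_.RiemannHypothesis → ScrewFloorLimsupQuarter) :=
  ⟨fun h _ => h, fun h => (em _root_.RiemannHypothesis).elim h
    screwFloorLimsupQuarter_of_not_riemannHypothesis⟩

/-- **A Rayleigh quotient bounds the floor constant from above when `S_M ≻ 0`** (then the Rayleigh
set is bounded below by `0`): `c(M) ≤ M · vᵀS_Mv/vᵀv` for every `v ≠ 0`. [folklore] -/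
theorem screwFloor_le_of_posDef {M : ℕ} (h : (screwMatrix (M - 1)).PosDef) {v : Fin (M - 1) → ℝ}
    (hv : v ≠ 0) : screwFloor M ≤ (M : ℝ) * screwRayleigh M v := by
  rw [screwFloor_eq]
  refine mul_le_mul_of_nonneg_left (csInf_le ?_ ⟨v, hv, rfl⟩) (Nat.cast_nonneg M)
  refine ⟨0, ?_⟩
  rintro q ⟨w, hw, rfl⟩
  have hww : 0 < w ⬝ᵥ w := dotProduct_self_pos' hw
  have hpos : 0 < w ⬝ᵥ (screwMatrix (M - 1) *ᵥ w) := by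
    simpa only [star_trivial] using h.dotProduct_mulVec_pos hw
  unfold screwRayleigh
  exact (div_pos hpos hww).le

/-- Conversely, the floor constant is approached by Rayleigh quotients: for every `δ > 0` some
`v ≠ 0` has `M · vᵀS_Mv/vᵀv < c(M) + δ` (`M ≥ 2`; no definiteness needed — if the Rayleigh set were
unbounded below, `c(M)` is the junk value `0` and the claim still holds). [folklore] -/
theorem exists_screwRayleigh_lt {M : ℕ} (hM : 2 ≤ M) {δ : ℝ} (hδ : 0 < δ) :
    ∃ v : Fin (M - 1) → ℝ, v ≠ 0 ∧ (M : ℝ) * screwRayleigh M v < screwFloor M + δ := by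
  have hk1 : 1 ≤ M - 1 := by omega
  have hMpos : (0 : ℝ) < M := by exact_mod_cast (by omega : 0 < M)
  have hne : (rayleighSet M).Nonempty :=
    ⟨screwRayleigh M (Pi.single ⟨0, hk1⟩ 1), Pi.single ⟨0, hk1⟩ 1,
      by simp [Pi.single_eq_zero_iff], rfl⟩
  have hlt : sInf (rayleighSet M) < sInf (rayleighSet M) + δ / M := by
    have : 0 < δ / M := div_pos hδ hMpos
    linarith
  obtain ⟨q, ⟨v, hv, rfl⟩, hq⟩ := exists_lt_of_csInf_lt hne hlt
  refine ⟨v, hv, ?_⟩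
  rw [screwFloor_eq]
  have := mul_lt_mul_of_pos_left hq hMpos
  rw [mul_add, mul_div_cancel₀ _ hMpos.ne'] at this
  exact this

/-- **THEOREM B ⟸ trial vectors on positive definite matrices.** It suffices to exhibit, for every
`ε > 0` and all large `M` with `S_M ≻ 0`, a nonzero `v` with `M·vᵀS_Mv/vᵀv ≤ 1/4 + (a′+ε)/log M`;
for `S_M ⊁ 0`, `c(M) ≤ 0` is automatic — so this form is also the `¬RH` branch (under `¬RH` the
hypothesis is eventually vacuous).  This is the exact shape of TRIAL-BOUND-THEOREM's architecture
(the Euler-ended eta vector). [folklore] -/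
theorem screwFloorTrialBound_of_trialVectors
    (h : ∀ ε : ℝ, 0 < ε → ∀ᶠ M : ℕ in atTop, (screwMatrix (M - 1)).PosDef →
      ∃ v : Fin (M - 1) → ℝ, v ≠ 0 ∧
        (M : ℝ) * screwRayleigh M v ≤ 1 / 4 + (screwFloorFirstOrderConst + ε) / Real.log M) :
    ScrewFloorTrialBound := by
  intro ε hε
  filter_upwards [h ε hε, eventually_quarter_add_div_log_nonneg (screwFloorFirstOrderConst + ε)]
    with M hM h0
  by_cases hPD : (screwMatrix (M - 1)).PosDef
  · obtain ⟨v, hv, hle⟩ := hM hPD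
    exact (screwFloor_le_of_posDef hPD hv).trans hle
  · exact (screwFloor_nonpos_of_not_posDef hPD).trans h0

/-- **THEOREM B ⟹ trial vectors** (with `ε`-room: apply the law at `ε/2` and approximate the infimum
to within `(ε/2)/log M`). [folklore] -/
theorem trialVectors_of_screwFloorTrialBound (h : ScrewFloorTrialBound) :
    ∀ ε : ℝ, 0 < ε → ∀ᶠ M : ℕ in atTop, (screwMatrix (M - 1)).PosDef →
      ∃ v : Fin (M - 1) → ℝ, v ≠ 0 ∧
        (M : ℝ) * screwRayleigh M v ≤ 1 / 4 + (screwFloorFirstOrderConst + ε) / Real.log M := by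
  intro ε hε
  have hlog1 : ∀ᶠ M : ℕ in atTop, 1 ≤ Real.log (M : ℝ) :=
    (Real.tendsto_log_atTop.comp tendsto_natCast_atTop_atTop).eventually (eventually_ge_atTop 1)
  filter_upwards [h (ε / 2) (half_pos hε), hlog1, eventually_ge_atTop 2] with M hM hlogM hM2 _
  have hlog0 : 0 < Real.log (M : ℝ) := by linarith
  obtain ⟨v, hv, hlt⟩ := exists_screwRayleigh_lt hM2 (div_pos (half_pos hε) hlog0)
  refine ⟨v, hv, ?_⟩
  have hsplit : (screwFloorFirstOrderConst + ε) / Real.log M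
      = (screwFloorFirstOrderConst + ε / 2) / Real.log M + (ε / 2) / Real.log M := by
    rw [← add_div]; ring_nf
  rw [hsplit]
  linarith

/-- **THEOREM B in trial-vector form (an equivalence).** [folklore] -/
theorem screwFloorTrialBound_iff_trialVectors :
    ScrewFloorTrialBound ↔
      ∀ ε : ℝ, 0 < ε → ∀ᶠ M : ℕ in atTop, (screwMatrix (M - 1)).PosDef →
        ∃ v : Fin (M - 1) → ℝ, v ≠ 0 ∧
          (M : ℝ) * screwRayleigh M v ≤ 1 / 4 + (screwFloorFirstOrderConst + ε) / Real.log M :=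
  ⟨trialVectors_of_screwFloorTrialBound, screwFloorTrialBound_of_trialVectors⟩

end Summit.RiemannHypothesis.RiemannHypothesis.Theorems.IntegerScrew
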